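import Summits.QuantumFields.YangMills.Theorems.FluctuationComparisonRegPrIntLS2BetaFlatInteriorDepthUniform
import Summits.QuantumFields.YangMills.Theorems.FluctuationComparisonRegPrIntLS2BetaBoxGaugeCoOptimisedRoot
import HarnessLib

/-!
# THE INTRA-BLOCK HALF OF THE FLAT ORBIT FUNCTIONAL WITH CO-OPTIMISED ROOTS: (6) re-run through (10), the block gauges and their roots EXPOSED
# (crux `FluctuationComparisonRegPrIntL`, stmt-QuantumFields-20520; registry v11.4 `Cruxes/FluctuationComparisonRegPrIntL/Lines/semiclassical_s2beta.lean` 3732b7df FROZEN, untouched)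

Cell `ym3-torus` (YM ladder rung R3 = continuum `SU(2)` Yang–Mills on the three-torus — a RUNG: NOT d = 4, NOT infinite volume, NOT a mass gap, NOT Clay).
Width seat `ym3-torus-px12` (gen 22); `--kind proof --supports stmt-QuantumFields-20520 --as helper`, count-neutral, DEFINITION-FREE (0 `def`, 0 `instance`,
0 `notation`, 0 `sorry`, default heartbeats).

WHY.  ✓p811720 (6) glues px19's best-root axial box gauges on the `m`-blocks into one rooted (residual) transformation `w` with `Σ_{intra} dist1(U ℓ·((w • 1) ℓ)⁻¹)² ≤ 9·L^{2m}·Σ_p dist1²`,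
but hides the gauges and their roots behind `∃ w`.  The inter-block («mean part») step of the road to the depth-uniform `hFlat` (HOME note `ym3-torus-px12/g22/HFLAT-ROAD-AFTER-6.px12g22.md`
§5; instr1 g14 FL-27 (4)) must choose each block's root ALSO for a second functional `Φ_y(r)` (the mean-part cost of the axial gauge rooted at `r`; a fixed root carries a `log`, the `L^m` candidate
roots together do not).  ✓(10) `exists_root_gauge_sum_sq_le_and` does that per box; this file re-runs (6) through it: the roots `r y < L^m`, the gauges `g y` (axial on the box of `y`, rooted at
`corner + r(y)·e₀`), the explicit formula `w x = (g_{B x} x)⁻¹·g_{B x}(centre)`, the intra-block bound with constant `18` (= 2·9), and `L^m·Φ_y(r y) ≤ 2·Σ_{r′<L^m} Φ_y(r′)` for every block.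

WHAT.  ★★★ `exists_rooted_sum_intraBlock_sq_le_and` — (6)'s `exists_rooted_sum_intraBlock_sq_le` with `(Φ : Site m → ℕ → ℝ) (hΦ : 0 ≤ Φ)` and the conjuncts above.

HONEST: quantifier bookkeeping over (6) and (10); `Φ` is a free binder (no mean-part letter proved); nothing of Bałaban's analysis; hFlat, TUBE-REG∘, GAP♯∘, EXW∘, S2β, crux 20520 NOT proved;
no registered stub is closed; rung R3 = SU(2) YM₃ on T³ — NOT d = 4, NOT infinite volume, NOT a mass gap, NOT Clay; the Yang–Mills mass gap is NOT proved.  Sorry-free, axioms standard.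

References: K. Uhlenbeck, CMP **83** (1982) 31–42 [Uhlenbeck1982]; T. Bałaban, CMP **96** (1984) 223–250 [Balaban1984PropagatorsII] ((1.33)); CMP **99** (1985) 75–102 [Balaban1985RegularSpaces]
(Lemma 1 p.79); CMP **109** (1987) 249–301 [Balaban1987RG1] ((0.1)–(0.3) p.252).
-/

set_option autoImplicit false

noncomputable section

namespace Summit.QuantumFields.YangMills.Theorems.FluctuationComparisonRegPrIntLS2BetaFlatInteriorCoOptimised

open Finset
open Literature.MathematicalPhysics.QuantumFieldTheory.Balaban1983to89
open T4Continuum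
open T3ContinuumYM3Torus
open T4AxialGaugeSmallField (boxPlaqs castSite castSite_apply pull)
open B7Prop1Explicit (e e_apply axialFn)
open B5Eq118OneStroke (iterBlockOf val_iterBlockOf)
open B15DeterminingSets (embIter)
open Literature.MathematicalPhysics.QuantumFieldTheory.BalabanImbrieJaffe1984to88.BIJ88RT51Background (iterBlockOf_embIter)
open Summit.QuantumFields.YangMills.Theorems.FluctuationComparisonRegPrIntLS2BetaFlatInteriorDepthUniform (val_corner box_of_iterBlockOf iterBlockOf_of_mem_boxPlaqs)
open Summit.QuantumFields.YangMills.Theorems.FluctuationComparisonRegPrIntLS2BetaBoxGaugeCoOptimisedRoot (exists_root_gauge_sum_sq_le_and)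

open scoped Matrix.Norms.L2Operator

variable (F : T3Family)

/-- ★★★ **THE INTRA-BLOCK HALF WITH CO-OPTIMISED ROOTS, GAUGES EXPOSED**: for every member `F.P K`, depth `m ≤ F.m + K`, field `U` and non-negative `Φ : Site m → ℕ → ℝ` there are roots
`r y < L^m`, gauges `g y` equal on the box of `y` to the axial gauge rooted at `corner(y) + r(y)·e₀`, and the glued rooted transformation `w x = (g_{B x} x)⁻¹·g_{B x}(centre of B x)` (`w ≡ 1` at
the centres) with `Σ_{ℓ : B_m(ℓ₋) = B_m(ℓ₊)} dist1(U ℓ·((w • 1) ℓ)⁻¹)² ≤ 18·(L^m)²·Σ_p dist1(U(∂p))²` AND `L^m·Φ_y(r y) ≤ 2·Σ_{r′<L^m} Φ_y(r′)` for every block `y`.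
[cite: Balaban1985RegularSpaces, Lemma 1 (1.25) p.79; Balaban1984PropagatorsII, (1.33)] -/
theorem exists_rooted_sum_intraBlock_sq_le_and (K m : ℕ) (hm : m ≤ F.m + K) (U : GaugeField (F.P K) 0 (Matrix.specialUnitaryGroup (Fin 2) ℂ))
    (Φ : Site (F.P K) m → ℕ → ℝ) (hΦ : ∀ y r, 0 ≤ Φ y r) :
    ∃ (r : Site (F.P K) m → ℕ) (g : Site (F.P K) m → GaugeTransf (F.P K) 0 (Matrix.specialUnitaryGroup (Fin 2) ℂ))
      (w : Site (F.P K) 0 → (Matrix.specialUnitaryGroup (Fin 2) ℂ)),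
      (∀ y, r y < F.L ^ m) ∧
      (∀ y (x : Fin (F.P K).d → ℤ), (fun k => (((((y k).val * (F.P K).L ^ m : ℕ) : ZMod ((F.P K).sitesPerDir 0))).val : ℤ)) ≤ x →
          x ≤ (fun k => (((((y k).val * (F.P K).L ^ m : ℕ) : ZMod ((F.P K).sitesPerDir 0))).val : ℤ) + ((F.L ^ m - 1 : ℕ) : ℤ)) →
          g y (castSite x) = axialFn (pull U) ((fun k => (((((y k).val * (F.P K).L ^ m : ℕ) : ZMod ((F.P K).sitesPerDir 0))).val : ℤ)) + (r y : ℤ) • e 0) x) ∧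
      (∀ x, w x = (g (iterBlockOf m x) x)⁻¹ * g (iterBlockOf m x) (embIter m (iterBlockOf m x))) ∧
      (∀ y, ((F.L ^ m : ℕ) : ℝ) * Φ y (r y) ≤ 2 * ∑ r' ∈ Finset.range (F.L ^ m), Φ y r') ∧
      (∀ y : Site (F.P K) m, w (embIter m y) = 1) ∧
      ∑ ℓ ∈ univ.filter (fun ℓ : PBond (F.P K) 0 => iterBlockOf m ℓ.src = iterBlockOf m ℓ.tgt),
          dist1 (U ℓ * ((GaugeField.gaugeAct w (1 : GaugeField (F.P K) 0 (Matrix.specialUnitaryGroup (Fin 2) ℂ))) ℓ)⁻¹) ^ 2 ≤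
        18 * ((F.L : ℝ) ^ m) ^ 2 * ∑ p : Plaq (F.P K) 0, dist1 (GaugeField.plaqHol U p) ^ 2 := by
  classical
  have hk : m ≤ (F.P K).m + (F.P K).K := hm
  have hLm : 0 < F.L ^ m := pow_pos (F.P K).L_pos m
  have hn : 1 ≤ (F.P K).L ^ m := hLm
  have h2n : 2 * (F.P K).L ^ m ≤ (F.P K).sitesPerDir 0 := by
    show 2 * F.L ^ m ≤ 2 * F.L ^ (F.m + K - 0)
    exact Nat.mul_le_mul_left _ (Nat.pow_le_pow_right (F.P K).L_pos (by omega))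
  -- the box gauges, one per `m`-block
  have hex : ∀ y : Site (F.P K) m, ∃ r, r < (F.P K).L ^ m ∧ ∃ g : GaugeTransf (F.P K) 0 (Matrix.specialUnitaryGroup (Fin 2) ℂ),
      (∀ x : Fin (F.P K).d → ℤ, (fun k => (((fun μ => ((((y μ).val * (F.P K).L ^ m : ℕ)) : ZMod ((F.P K).sitesPerDir 0))) k).val : ℤ)) ≤ x →
          x ≤ (fun k => (((fun μ => ((((y μ).val * (F.P K).L ^ m : ℕ)) : ZMod ((F.P K).sitesPerDir 0))) k).val : ℤ) + (((F.P K).L ^ m - 1 : ℕ) : ℤ)) →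
          g (castSite x) = axialFn (pull U) ((fun k => (((fun μ => ((((y μ).val * (F.P K).L ^ m : ℕ)) : ZMod ((F.P K).sitesPerDir 0))) k).val : ℤ)) + (r : ℤ) • e 0) x) ∧
      (∑ b ∈ univ.filter (fun b : PBond (F.P K) 0 =>
          (∀ k, (b.src k - (fun μ => ((((y μ).val * (F.P K).L ^ m : ℕ)) : ZMod ((F.P K).sitesPerDir 0))) k).val < (F.P K).L ^ m) ∧
          (∀ k, (b.tgt k - (fun μ => ((((y μ).val * (F.P K).L ^ m : ℕ)) : ZMod ((F.P K).sitesPerDir 0))) k).val < (F.P K).L ^ m)),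
          dist1 (GaugeField.gaugeAct g U b) ^ 2) ≤
        2 * ((3 * (((F.P K).L ^ m : ℕ) : ℝ)) ^ 2 * (∑ p ∈ univ.filter (fun p : Plaq (F.P K) 0 => p ∈ boxPlaqs (P := F.P K) (j := 0)
          (fun k => (((fun μ => ((((y μ).val * (F.P K).L ^ m : ℕ)) : ZMod ((F.P K).sitesPerDir 0))) k).val : ℤ))
          (fun k => (((fun μ => ((((y μ).val * (F.P K).L ^ m : ℕ)) : ZMod ((F.P K).sitesPerDir 0))) k).val : ℤ) + ((((F.P K).L ^ m : ℕ) : ℤ) - 1))),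
          dist1 (GaugeField.plaqHol U p) ^ 2)) ∧
      (((F.P K).L ^ m : ℕ) : ℝ) * Φ y r ≤ 2 * ∑ r' ∈ Finset.range ((F.P K).L ^ m), Φ y r' := by
    intro y
    obtain ⟨r, hr, g, hg1, hg2, hg3⟩ := exists_root_gauge_sum_sq_le_and F K U hn h2n _ (Φ y) (hΦ y)
    exact ⟨r, hr, g, hg1, hg2, hg3⟩
  choose r hr g hga hg hgΦ using hex
  refine ⟨r, g, fun x => (g (iterBlockOf m x) x)⁻¹ * g (iterBlockOf m x) (embIter m (iterBlockOf m x)), hr, hga, fun x => rfl, hgΦ, fun y => ?_, ?_⟩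
  · simp only [iterBlockOf_embIter m hk y, inv_mul_cancel]
  -- reorganise the intra-block sum by blocks
  set f : PBond (F.P K) 0 → ℝ := fun ℓ => dist1 (U ℓ * ((GaugeField.gaugeAct
      (fun x => (g (iterBlockOf m x) x)⁻¹ * g (iterBlockOf m x) (embIter m (iterBlockOf m x))) (1 : GaugeField (F.P K) 0 (Matrix.specialUnitaryGroup (Fin 2) ℂ))) ℓ)⁻¹) ^ 2 with hf
  have hf0 : ∀ ℓ, 0 ≤ f ℓ := fun ℓ => sq_nonneg _
  rw [← Finset.sum_fiberwise (univ.filter (fun ℓ : PBond (F.P K) 0 => iterBlockOf m ℓ.src = iterBlockOf m ℓ.tgt)) (fun ℓ => iterBlockOf m ℓ.src) f]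
  -- per block: the glued transformation reads as the box gauge, and the intra-block bonds lie in the box
  have hblock : ∀ y : Site (F.P K) m,
      ∑ ℓ ∈ (univ.filter (fun ℓ : PBond (F.P K) 0 => iterBlockOf m ℓ.src = iterBlockOf m ℓ.tgt)).filter (fun ℓ => iterBlockOf m ℓ.src = y), f ℓ ≤
        2 * ((3 * (((F.P K).L ^ m : ℕ) : ℝ)) ^ 2 * (∑ p ∈ univ.filter (fun p : Plaq (F.P K) 0 => p ∈ boxPlaqs (P := F.P K) (j := 0)
          (fun k => (((fun μ => ((((y μ).val * (F.P K).L ^ m : ℕ)) : ZMod ((F.P K).sitesPerDir 0))) k).val : ℤ))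
          (fun k => (((fun μ => ((((y μ).val * (F.P K).L ^ m : ℕ)) : ZMod ((F.P K).sitesPerDir 0))) k).val : ℤ) + ((((F.P K).L ^ m : ℕ) : ℤ) - 1))),
          dist1 (GaugeField.plaqHol U p) ^ 2)) := by
    intro y
    refine le_trans ?_ (hg y)
    refine le_trans (le_of_eq (Finset.sum_congr rfl fun ℓ hℓ => ?_)) (Finset.sum_le_sum_of_subset_of_nonneg (fun ℓ hℓ => ?_) fun _ _ _ => sq_nonneg _)
    · -- the value on an intra-block bond of block `y`
      rw [Finset.mem_filter, Finset.mem_filter] at hℓ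
      obtain ⟨⟨-, hst⟩, hsy⟩ := hℓ
      have hty : iterBlockOf m ℓ.tgt = y := hst ▸ hsy
      simp only [hf]
      have e : U ℓ * ((GaugeField.gaugeAct
          (fun x => (g (iterBlockOf m x) x)⁻¹ * g (iterBlockOf m x) (embIter m (iterBlockOf m x))) (1 : GaugeField (F.P K) 0 (Matrix.specialUnitaryGroup (Fin 2) ℂ))) ℓ)⁻¹ =
          (g y ℓ.src)⁻¹ * GaugeField.gaugeAct (g y) U ℓ * ((g y ℓ.src)⁻¹)⁻¹ := by
        show U ℓ * ((g (iterBlockOf m ℓ.src) ℓ.src)⁻¹ * g (iterBlockOf m ℓ.src) (embIter m (iterBlockOf m ℓ.src)) * 1 *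
            ((g (iterBlockOf m ℓ.tgt) ℓ.tgt)⁻¹ * g (iterBlockOf m ℓ.tgt) (embIter m (iterBlockOf m ℓ.tgt)))⁻¹)⁻¹ =
          (g y ℓ.src)⁻¹ * (g y ℓ.src * U ℓ * (g y ℓ.tgt)⁻¹) * ((g y ℓ.src)⁻¹)⁻¹
        rw [hsy, hty]
        group
      rw [e, GaugeGroup.dist1_conj]
    · rw [Finset.mem_filter, Finset.mem_filter] at hℓ
      obtain ⟨⟨-, hst⟩, hsy⟩ := hℓ
      have hty : iterBlockOf m ℓ.tgt = y := hst ▸ hsy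
      rw [Finset.mem_filter]
      exact ⟨Finset.mem_univ _, fun k => box_of_iterBlockOf hk hsy k, fun k => box_of_iterBlockOf hk hty k⟩
  -- the box plaquette sums add up to at most the total
  have hplaq : ∑ y : Site (F.P K) m, ∑ p ∈ univ.filter (fun p : Plaq (F.P K) 0 => p ∈ boxPlaqs (P := F.P K) (j := 0)
          (fun k => (((fun μ => ((((y μ).val * (F.P K).L ^ m : ℕ)) : ZMod ((F.P K).sitesPerDir 0))) k).val : ℤ))
          (fun k => (((fun μ => ((((y μ).val * (F.P K).L ^ m : ℕ)) : ZMod ((F.P K).sitesPerDir 0))) k).val : ℤ) + ((((F.P K).L ^ m : ℕ) : ℤ) - 1))),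
          dist1 (GaugeField.plaqHol U p) ^ 2 ≤ ∑ p : Plaq (F.P K) 0, dist1 (GaugeField.plaqHol U p) ^ 2 := by
    rw [← Finset.sum_fiberwise (univ : Finset (Plaq (F.P K) 0)) (fun p => iterBlockOf m p.src) (fun p => dist1 (GaugeField.plaqHol U p) ^ 2)]
    refine Finset.sum_le_sum fun y _ => Finset.sum_le_sum_of_subset_of_nonneg (fun p hp => ?_) fun _ _ _ => sq_nonneg _
    rw [Finset.mem_filter] at hp ⊢
    exact ⟨Finset.mem_univ _, iterBlockOf_of_mem_boxPlaqs hk y p hp.2⟩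
  have hL : (((F.P K).L ^ m : ℕ) : ℝ) = (F.L : ℝ) ^ m := by push_cast; rfl
  calc ∑ y : Site (F.P K) m, ∑ ℓ ∈ (univ.filter (fun ℓ : PBond (F.P K) 0 => iterBlockOf m ℓ.src = iterBlockOf m ℓ.tgt)).filter
          (fun ℓ => iterBlockOf m ℓ.src = y), f ℓ
      ≤ ∑ y : Site (F.P K) m, 2 * ((3 * (((F.P K).L ^ m : ℕ) : ℝ)) ^ 2 * (∑ p ∈ univ.filter (fun p : Plaq (F.P K) 0 => p ∈ boxPlaqs (P := F.P K) (j := 0)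
          (fun k => (((fun μ => ((((y μ).val * (F.P K).L ^ m : ℕ)) : ZMod ((F.P K).sitesPerDir 0))) k).val : ℤ))
          (fun k => (((fun μ => ((((y μ).val * (F.P K).L ^ m : ℕ)) : ZMod ((F.P K).sitesPerDir 0))) k).val : ℤ) + ((((F.P K).L ^ m : ℕ) : ℤ) - 1))),
          dist1 (GaugeField.plaqHol U p) ^ 2)) := Finset.sum_le_sum fun y _ => hblock y
    _ = 2 * (3 * (((F.P K).L ^ m : ℕ) : ℝ)) ^ 2 * ∑ y : Site (F.P K) m, ∑ p ∈ univ.filter (fun p : Plaq (F.P K) 0 => p ∈ boxPlaqs (P := F.P K) (j := 0)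
          (fun k => (((fun μ => ((((y μ).val * (F.P K).L ^ m : ℕ)) : ZMod ((F.P K).sitesPerDir 0))) k).val : ℤ))
          (fun k => (((fun μ => ((((y μ).val * (F.P K).L ^ m : ℕ)) : ZMod ((F.P K).sitesPerDir 0))) k).val : ℤ) + ((((F.P K).L ^ m : ℕ) : ℤ) - 1))),
          dist1 (GaugeField.plaqHol U p) ^ 2 := by rw [Finset.mul_sum]; refine Finset.sum_congr rfl fun y _ => ?_; ring
    _ ≤ 2 * (3 * (((F.P K).L ^ m : ℕ) : ℝ)) ^ 2 * ∑ p : Plaq (F.P K) 0, dist1 (GaugeField.plaqHol U p) ^ 2 := mul_le_mul_of_nonneg_left hplaq (by positivity)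
    _ = 18 * ((F.L : ℝ) ^ m) ^ 2 * ∑ p : Plaq (F.P K) 0, dist1 (GaugeField.plaqHol U p) ^ 2 := by rw [hL]; ring


end Summit.QuantumFields.YangMills.Theorems.FluctuationComparisonRegPrIntLS2BetaFlatInteriorCoOptimised

end
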